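import Summits.ABC.ABC.Theorems.IneffectiveSubspaceUniformSadicTowerFourThreeSlotShapes

/-!
# `UniformSadicTowerFour` (stmt-ABC-14937), line `flat-steep-split` (lead c4): the first open
# rung `W = 3` of BoundedOmegaABC is at least prime-Fermat–Catalan-hard (hardness certificate)

Modulo the route's crux #6 the crux `UniformSadicTowerFour` is BoundedOmegaABC: abc with a
constant `C(W, ε)` on every cell `{ω(abc) ≤ W}`.  Its first OPEN rung `W = 3` (`B₃`) is
equivalent (`boundedOmegaAt_three_iff_shapes`) to abc, with the bound `c < C(ε) · (pqr)^(1+ε)`, on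
three exponential shapes with prime bases `p, q, r`, the third being shape (C):
`p^x + q^y = r^z` with `p ≠ q`.

This file is the honesty certificate "rung `3` is at least Fermat–Catalan-hard": shape (C) ALONE
forces the prime-base GENERALIZED FERMAT EQUATION OF HYPERBOLIC SIGNATURE,

  `p^x + q^y = r^z`, `p, q, r` prime, `p ≠ q`, `1/x + 1/y + 1/z < 1`
  (solutions `2⁵ + 7² = 3⁴`, `7³ + 13² = 2⁹`, `2⁷ + 17³ = 71²`),

to have BOUNDED solutions — `r^z ≤ N` for one `N`, uniformly over ALL hyperbolic signatures
`(x, y, z)` at once (`primeFermatCatalan_bounded_of_shapeC`) — hence so does `B₃`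
(`primeFermatCatalan_bounded_of_boundedOmegaAt_three`).  Since `p^x, q^y ≤ r^z ≤ N` and all bases
and exponents are `≥ 2`, bounded means finitely many solutions `(p, q, r, x, y, z)`: this is the
prime-base case of the FERMAT–CATALAN CONJECTURE (finitely many coprime solutions of
`a^x + b^y = c^z` with `1/x + 1/y + 1/z < 1`, all signatures together), which is OPEN, also for
prime bases.  What is known is one signature at a time: for each FIXED hyperbolic `(x, y, z)` the
coprime solutions are finite in number (Darmon–Granville 1995, via Faltings; ineffective).  So a
proof of `B₃` would in particular settle prime-base Fermat–Catalan: the rung is at least that hard.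

**Proof.** (i) The hyperbolic gap (`hyperbolic_signature_gap`): for natural numbers,
`1/x + 1/y + 1/z < 1` forces `1/x + 1/y + 1/z ≤ 41/42` (the largest value below `1` is
`1/2 + 1/3 + 1/7`), in cleared denominators `yz + xz + xy < xyz ⟹ 42(yz + xz + xy) ≤ 41xyz`;
a finite case analysis on the sorted triple `x ≤ y ≤ z` (`x ≥ 4`: all three `≥ 4`; `x = 3`:
`y = 3, z ≥ 4` or `y ≥ 4`; `x = 2`: `y = 3, z ≥ 7` or `y = 4, z ≥ 5` or `y ≥ 5`; `x ≤ 1` is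
excluded by the hypothesis), the unsorted statement by symmetry.  (ii) Fix `ε := 1/42` and its
shape-(C) constant `C`.  Let `p^x + q^y = r^z =: c` be a solution of hyperbolic signature, so
`xyz > 0` and `p^x, q^y ≤ c`.  Then `(pqr)^{xyz} = (p^x)^{yz} (q^y)^{xz} (r^z)^{xy} ≤ c^{yz+xz+xy}`,
so by (i) `(pqr)^{42·xyz} ≤ c^{42(yz+xz+xy)} ≤ c^{41·xyz}` and, extracting the `xyz`-th root,
`(pqr)^42 ≤ c^41` (`fermatCatalan_pow_le`, in `ℕ`).  (iii) Raise `c < C · (pqr)^{1 + 1/42}` to the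
power `1764 = 42²`: `c^1764 < C^1764 · (pqr)^1806 = C^1764 · ((pqr)^42)^43 ≤ C^1764 · c^1763`, so
`c < C^1764` (`fermatCatalan_lt`): every solution has `r^z ≤ N := ⌈C^1764⌉₊`, a constant depending
only on `C = C(1/42)` (deliberately crude; no case split on the signature).

Sources: elementary [folklore].  Context only (not used): H. Darmon, A. Granville, *On the
equations `z^m = F(x, y)` and `Ax^p + By^q = Cz^r`*, Bull. London Math. Soc. 27 (1995) 513–543
(finiteness for each fixed hyperbolic signature); the Fermat–Catalan conjecture (finiteness over
all hyperbolic signatures) is open.  Mathlib only (`Nat.pow_le_pow_left/right`,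
`Nat.pow_le_pow_iff_left`, `pow_lt_pow_left₀`, `pow_le_pow_left₀`, `Real.rpow_natCast`,
`Real.rpow_mul`, `Nat.le_ceil`, `interval_cases`, `linarith`) and `boundedOmegaAt_three_iff_shapes`.
No new definitions.  Deliberately NOT here: the rung `B₃` itself and the Fermat–Catalan conjecture
(both OPEN; `B₃` appears only as the explicit hypothesis `hB` of the corollary), Darmon–Granville,
and the other stubs of the line.
-/

noncomputable section

-- `Summit.<Summit>.<Problem>` is the mandated summit-side namespace (CONVENTIONS §2); for the
-- single-conjunct summit `ABC` the two coincide, so the duplicate `ABC.ABC` is deliberate.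
set_option linter.dupNamespace false

namespace Summit.ABC.ABC.Theorems.UniformSadicTowerFour.BoundedOmega

open Literature.NumberTheory.DiophantineGeometry (IsABCTriple rad)

/-! ## The hyperbolic gap `1/x + 1/y + 1/z < 1 ⟹ 1/x + 1/y + 1/z ≤ 41/42` -/

/-- The hyperbolic gap for a SORTED triple `x ≤ y ≤ z` of natural numbers, in cleared
denominators: `yz + xz + xy < xyz` (i.e. `1/x + 1/y + 1/z < 1`, which forces `x ≥ 2`) implies
`42(yz + xz + xy) ≤ 41xyz` (i.e. `1/x + 1/y + 1/z ≤ 41/42 = 1/2 + 1/3 + 1/7`).  Finite case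
analysis: `x ≥ 4` (then `4yz, 4xz, 4xy ≤ xyz`); `x = 3` with `y = 3, z ≥ 4` or `y ≥ 4`; `x = 2`
with `y = 3, z ≥ 7`, `y = 4, z ≥ 5`, or `y ≥ 5`. [folklore] -/
private theorem hyperbolic_signature_gap_sorted {x y z : ℕ} (hxy : x ≤ y) (hyz : y ≤ z)
    (h : y * z + x * z + x * y < x * y * z) :
    42 * (y * z + x * z + x * y) ≤ 41 * (x * y * z) := by
  have h0 : 0 ≤ x * y * z := Nat.zero_le _
  rcases Nat.lt_or_ge x 4 with hx4 | hx4
  swap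
  · -- `4 ≤ x ≤ y ≤ z`: `1/x + 1/y + 1/z ≤ 3/4`
    have h1 : 4 * (y * z) ≤ x * (y * z) := Nat.mul_le_mul_right _ hx4
    have h2 : 4 * (x * z) ≤ y * (x * z) := Nat.mul_le_mul_right _ (hx4.trans hxy)
    have h3 : 4 * (x * y) ≤ z * (x * y) := Nat.mul_le_mul_right _ (hx4.trans (hxy.trans hyz))
    linarith
  interval_cases x
  · -- `x = 0`: the hypothesis reads `yz < 0`
    simp at h
  · -- `x = 1`: the hypothesis reads `yz + z + y < yz`
    linarith
  · -- `x = 2`: the hypothesis reads `2y + 2z < yz`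
    rcases Nat.lt_or_ge y 5 with hy5 | hy5
    swap
    · -- `5 ≤ y ≤ z`: `84(y + z) ≤ 40yz`
      have h1 : 5 * z ≤ y * z := Nat.mul_le_mul_right _ hy5
      have h2 : 5 * y ≤ z * y := Nat.mul_le_mul_right _ (hy5.trans hyz)
      linarith
    -- `y = 2` is excluded, `y = 3` forces `z ≥ 7`, `y = 4` forces `z ≥ 5`
    interval_cases y <;> omega
  · -- `x = 3`: the hypothesis reads `3y + 3z < 2yz`
    rcases Nat.lt_or_ge y 4 with hy4 | hy4
    swap
    · -- `4 ≤ y ≤ z`: `126(y + z) ≤ 81yz`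
      have h1 : 4 * z ≤ y * z := Nat.mul_le_mul_right _ hy4
      have h2 : 4 * y ≤ z * y := Nat.mul_le_mul_right _ (hy4.trans hyz)
      linarith
    -- `y = 3` forces `z ≥ 4`
    interval_cases y; omega

/-- **hyperbolic_signature_gap (the hyperbolic gap `41/42`).** For natural numbers `x, y, z`,
`1/x + 1/y + 1/z < 1` forces `1/x + 1/y + 1/z ≤ 41/42` — the largest value of `1/x + 1/y + 1/z`
below `1` is `1/2 + 1/3 + 1/7 = 41/42` (the signature of the `(2, 3, 7)` triangle group) — stated in
cleared denominators: `yz + xz + xy < xyz ⟹ 42(yz + xz + xy) ≤ 41xyz`.  By symmetry from the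
sorted case `hyperbolic_signature_gap_sorted`. [folklore] -/
theorem hyperbolic_signature_gap {x y z : ℕ} (h : y * z + x * z + x * y < x * y * z) :
    42 * (y * z + x * z + x * y) ≤ 41 * (x * y * z) := by
  rcases le_total x y with hxy | hyx <;> rcases le_total y z with hyz | hzy
  · exact hyperbolic_signature_gap_sorted hxy hyz h
  · rcases le_total x z with hxz | hzx
    · have := hyperbolic_signature_gap_sorted hxz hzy (by linarith); linarith
    · have := hyperbolic_signature_gap_sorted hzx hxy (by linarith); linarith
  · rcases le_total x z with hxz | hzx
    · have := hyperbolic_signature_gap_sorted hyx hxz (by linarith); linarith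
    · have := hyperbolic_signature_gap_sorted hyz hzx (by linarith); linarith
  · have := hyperbolic_signature_gap_sorted hzy hyx (by linarith); linarith

/-! ## Size bookkeeping for `p^x + q^y = r^z` of hyperbolic signature -/

/-- Size bookkeeping for the generalized Fermat equation of hyperbolic signature (e.g.
`2⁵ + 7² = 3⁴`): if `p^x + q^y = r^z =: c` with `42(yz + xz + xy) ≤ 41xyz`, `xyz > 0` and
`c ≥ 1`, then `(pqr)^42 ≤ c^41`.  Indeed `p^x, q^y ≤ c`, so
`(pqr)^{xyz} = (p^x)^{yz} (q^y)^{xz} (r^z)^{xy} ≤ c^{yz + xz + xy}`, whence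
`((pqr)^42)^{xyz} ≤ c^{42(yz+xz+xy)} ≤ c^{41xyz} = (c^41)^{xyz}`; extract the `xyz`-th root
(e.g. `(2·7·3)^42 = 42^42 ≈ 1.5·10^68 ≤ 81^41 ≈ 1.8·10^78`). [folklore] -/
private theorem fermatCatalan_pow_le {p q r x y z : ℕ} (hE : p ^ x + q ^ y = r ^ z)
    (hg : 42 * (y * z + x * z + x * y) ≤ 41 * (x * y * z)) (hn : 0 < x * y * z)
    (hc : 1 ≤ r ^ z) : (p * q * r) ^ 42 ≤ (r ^ z) ^ 41 := by
  have hp : p ^ x ≤ r ^ z := hE ▸ Nat.le_add_right _ _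
  have hq : q ^ y ≤ r ^ z := hE ▸ Nat.le_add_left _ _
  have h1 : (p * q * r) ^ (x * y * z) ≤ (r ^ z) ^ (y * z + x * z + x * y) :=
    calc (p * q * r) ^ (x * y * z)
        = (p ^ x) ^ (y * z) * (q ^ y) ^ (x * z) * (r ^ z) ^ (x * y) := by ring
    _ ≤ (r ^ z) ^ (y * z) * (r ^ z) ^ (x * z) * (r ^ z) ^ (x * y) :=
        Nat.mul_le_mul_right _
          (Nat.mul_le_mul (Nat.pow_le_pow_left hp _) (Nat.pow_le_pow_left hq _))
    _ = (r ^ z) ^ (y * z + x * z + x * y) := by rw [pow_add, pow_add]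
  have h2 : ((p * q * r) ^ 42) ^ (x * y * z) ≤ ((r ^ z) ^ 41) ^ (x * y * z) :=
    calc ((p * q * r) ^ 42) ^ (x * y * z)
        = ((p * q * r) ^ (x * y * z)) ^ 42 := by rw [← pow_mul, ← pow_mul, Nat.mul_comm 42]
    _ ≤ ((r ^ z) ^ (y * z + x * z + x * y)) ^ 42 := Nat.pow_le_pow_left h1 42
    _ = (r ^ z) ^ (42 * (y * z + x * z + x * y)) := by rw [← pow_mul, Nat.mul_comm _ 42]
    _ ≤ (r ^ z) ^ (41 * (x * y * z)) := Nat.pow_le_pow_right hc hg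
    _ = ((r ^ z) ^ 41) ^ (x * y * z) := pow_mul _ _ _
  exact (Nat.pow_le_pow_iff_left hn.ne').mp h2

/-- The real-analysis bookkeeping of the certificate (e.g. `2⁵ + 7² = 3⁴`): from the shape-(C)
bound `c < C · M^(1 + 1/42)` and `M^42 ≤ c^41` (here `M = pqr`, `c = r^z`) follow, raising to the
power `1764 = 42²`, `c^1764 < C^1764 · M^1806 = C^1764 · (M^42)^43 ≤ C^1764 · c^1763`, i.e.
`c < C^1764`. [folklore] -/
private theorem fermatCatalan_lt {C M c : ℝ} (hC : 0 < C) (hM : 0 ≤ M) (hc : 0 ≤ c)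
    (h1 : c < C * M ^ ((1 : ℝ) + 1 / 42)) (h2 : M ^ 42 ≤ c ^ 41) : c < C ^ 1764 := by
  have h3 : c ^ 1764 < C ^ 1764 * M ^ 1806 := by
    calc c ^ 1764 < (C * M ^ ((1 : ℝ) + 1 / 42)) ^ 1764 := pow_lt_pow_left₀ h1 hc (by norm_num)
    _ = C ^ 1764 * M ^ 1806 := by
        rw [mul_pow, ← Real.rpow_natCast (M ^ ((1 : ℝ) + 1 / 42)), ← Real.rpow_mul hM]
        norm_num
  have h4 : M ^ 1806 ≤ c ^ 1763 := by
    calc M ^ 1806 = (M ^ 42) ^ 43 := by rw [← pow_mul]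
    _ ≤ (c ^ 41) ^ 43 := pow_le_pow_left₀ (by positivity) h2 43
    _ = c ^ 1763 := by rw [← pow_mul]
  have h5 : c * c ^ 1763 < C ^ 1764 * c ^ 1763 := by
    calc c * c ^ 1763 = c ^ 1764 := by rw [← pow_succ']
    _ < C ^ 1764 * M ^ 1806 := h3
    _ ≤ C ^ 1764 * c ^ 1763 := mul_le_mul_of_nonneg_left h4 (by positivity)
  exact lt_of_mul_lt_mul_right h5 (pow_nonneg hc _)

/-! ## The certificate: shape (C) bounds prime-base Fermat–Catalan -/

/-- **primeFermatCatalan_bounded_of_shapeC (hardness certificate of the rung `W = 3`).** abc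
with the bound `r^z < C(ε) · (pqr)^(1+ε)` on shape (C) `p^x + q^y = r^z` (`p, q, r` prime,
`p ≠ q`) forces the prime-base generalized Fermat equation of HYPERBOLIC SIGNATURE —
`p^x + q^y = r^z` with `p, q, r` prime, `p ≠ q` and `1/x + 1/y + 1/z < 1` (stated as
`yz + xz + xy < xyz`; e.g. `2⁵ + 7² = 3⁴`, `7³ + 13² = 2⁹`, `2⁷ + 17³ = 71²`) — to have bounded
solutions: `r^z ≤ N` for ONE `N` depending only on the constant `C(1/42)`, uniformly over all
hyperbolic signatures `(x, y, z)`; as `p^x, q^y ≤ r^z`, only finitely many prime-power solutions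
remain.  That is the prime-base case of the Fermat–Catalan conjecture, which is open (finiteness is
known only signature by signature, Darmon–Granville 1995), so the rung `W = 3` of BoundedOmegaABC
is at least that hard.  Proof: `ε := 1/42`; the hyperbolic gap gives `42(yz+xz+xy) ≤ 41xyz`
(`hyperbolic_signature_gap`), hence `(pqr)^42 ≤ (r^z)^41`; with `r^z < C · (pqr)^{43/42}` raised
to the power `1764` this yields `r^z < C^1764`. [folklore] -/
theorem primeFermatCatalan_bounded_of_shapeC
    (hC : ∀ ε : ℝ, 0 < ε → ∃ C : ℝ, 0 < C ∧ ∀ p q r x y z : ℕ, p.Prime → q.Prime → r.Prime →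
      p ≠ q → p ^ x + q ^ y = r ^ z → ((r ^ z : ℕ) : ℝ) < C * ((p * q * r : ℕ) : ℝ) ^ (1 + ε)) :
    ∃ N : ℕ, ∀ p q r x y z : ℕ, p.Prime → q.Prime → r.Prime → p ≠ q → p ^ x + q ^ y = r ^ z →
      y * z + x * z + x * y < x * y * z → r ^ z ≤ N := by
  obtain ⟨C, hC0, H⟩ := hC (1 / 42) (by norm_num)
  refine ⟨⌈C ^ 1764⌉₊, fun p q r x y z hp hq hr hpq hE hxyz => ?_⟩
  -- the shape-(C) instance `p ^ x + q ^ y = r ^ z` itself, with `ε = 1/42`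
  have h1 := H p q r x y z hp hq hr hpq hE
  have h2 : ((p * q * r : ℕ) : ℝ) ^ 42 ≤ ((r ^ z : ℕ) : ℝ) ^ 41 := by
    exact_mod_cast fermatCatalan_pow_le hE (hyperbolic_signature_gap hxyz)
      ((Nat.zero_le _).trans_lt hxyz) (Nat.one_le_pow _ _ hr.pos)
  have hlt : ((r ^ z : ℕ) : ℝ) < ((⌈C ^ 1764⌉₊ : ℕ) : ℝ) :=
    (fermatCatalan_lt hC0 (Nat.cast_nonneg _) (Nat.cast_nonneg _) h1 h2).trans_le (Nat.le_ceil _)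
  exact_mod_cast hlt.le

/-- **primeFermatCatalan_bounded_of_boundedOmegaAt_three.** The first open rung `W = 3` of
BoundedOmegaABC — abc with `C = C(ε)` on the cell `ω(abc) ≤ 3` (`B₃`, the hypothesis `hB`) —
implies that the prime-base generalized Fermat equation `p^x + q^y = r^z` (`p, q, r` prime,
`p ≠ q`) has only BOUNDED, hence finitely many, prime-power solutions of hyperbolic signature
`1/x + 1/y + 1/z < 1` (stated as `yz + xz + xy < xyz`; e.g. `2⁵ + 7² = 3⁴`, `7³ + 13² = 2⁹`,
`2⁷ + 17³ = 71²`), uniformly over ALL hyperbolic signatures at once — the prime-base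
Fermat–Catalan statement, which is open; so the rung is at least that hard.  By
`boundedOmegaAt_three_iff_shapes` the rung contains shape (C), and
`primeFermatCatalan_bounded_of_shapeC`. [folklore] -/
theorem primeFermatCatalan_bounded_of_boundedOmegaAt_three
    (hB : ∀ ε : ℝ, 0 < ε → ∃ C : ℝ, 0 < C ∧ ∀ a b c : ℕ, IsABCTriple a b c →
      (a * b * c).primeFactors.card ≤ 3 → (c : ℝ) < C * ((rad a b c : ℕ) : ℝ) ^ (1 + ε)) :
    ∃ N : ℕ, ∀ p q r x y z : ℕ, p.Prime → q.Prime → r.Prime → p ≠ q → p ^ x + q ^ y = r ^ z →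
      y * z + x * z + x * y < x * y * z → r ^ z ≤ N :=
  primeFermatCatalan_bounded_of_shapeC (boundedOmegaAt_three_iff_shapes.mp hB).2.2

end Summit.ABC.ABC.Theorems.UniformSadicTowerFour.BoundedOmega

end
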